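import Mathlib
import Literature.NumberTheory.LFunctions.Zhang2022.AppendixAStepAu007Read
import Literature.NumberTheory.LFunctions.Zhang2022.AppendixAEulerProductU004
import Literature.Analysis.Complex.HolomorphicProducts
import HarnessLib

/-!
# Zhang (2022), Appendix A part 1 (proof of Lemma 8.3): Z22:§A.u007 — both global sentences
# (`𝒰_j` analytic on `σ > 9/10`; `𝒰_j = ∏_{q<D}𝔱_j + O(D^{−c})` there) from the holomorphy of the
# local factors, kernel-checked

Topic `Literature/NumberTheory/LFunctions/Zhang2022` (Landau–Siegel audit tree; verdict-neutral).
Y. Zhang, *Discrete mean estimates and the Landau–Siegel zero*, arXiv:2211.02515v1 (2022)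
[Zhang2022LandauSiegel], Appendix A p. 101, tex L4999–L5002, **an unrefereed manuscript under
adjudication; nothing here asserts or denies its Theorems 1–2.** The two typed leaves of
`Skeleton.theorem1_of_leaves_v19` coming from this sentence are `Typed.AppendixA1.StepA_u007_analytic`
(`hAn`: `𝒰_j(d,h;·)` continues analytically to `σ > 9/10`) and `Typed.AppendixA1.StepA_u007_read`
(`hRead`: every such continuation is `∏_{q<D}𝔱_j + O(D^{−c})` there).

With the Euler product on `σ > 1` (`Lemma83.hasProd_frakt_calU`, file `AppendixAEulerProductU004`), the
convergence and tail of `∏'_q 𝔱_j` on `σ > 9/10` (`Lemma83.multipliable_frakt`,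
`norm_tprod_frakt_sub_prod_le`, file `AppendixAStepAu007ReadTail`), the identity-theorem closer
(`Lemma83.stepA_u007_read_of_core`, file `AppendixAStepAu007Read`) and the Weierstrass `M`-test for
holomorphic products (`Literature.Analysis.Complex.differentiableOn_tprod_of_norm_sub_one_le`, file
`HolomorphicProducts`) all in the tree, BOTH leaves reduce to ONE local statement: each factor
`s ↦ 𝔱_j(d,h,s;q)` is holomorphic on `σ > 9/10` (every prime `q`). This file PROVES that reduction
(theorems only, no definitions, no facts):

* `differentiableOn_tprod_frakt` — per-prime holomorphy ⇒ `s ↦ ∏'_q 𝔱_j(d,h,s;q)` holomorphic on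
  `σ > 9/10` (majorant `26·10⁶q^{−9/5} + [q ∣ dh]4q^{−9/10}` of `Lemma83.norm_frakt_sub_one_le_all`);
* `stepA_u007_analytic_of_factors`, `stepA_u007_read_of_factors` — the two leaves from the per-prime
  holomorphy (for all `D`, `χ`, `1 ≤ j ≤ 3`, `d, h ≥ 1`, primes `q`).

WHAT THIS IS NOT: a proof of the per-prime holomorphy itself (the normally convergent local series
`Σ_r χ(q^r)ξ_j(q^r;d,h)q^{−rs}`; in flight in the ZHANG-L lane), or of anything about Theorems 1–2.

## References

* Y. Zhang, arXiv:2211.02515v1 (2022), Appendix A p. 101 (tex L4999–L5002); §8 Lemma 8.3 p. 46.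
  [cite: Zhang2022LandauSiegel, App. A]
* J. B. Conway, *Functions of One Complex Variable I* (1978), VII.5 (products of holomorphic
  functions). [cite: Conway1978, VII.5]
-/

noncomputable section

open Complex Real Filter Topology Finset

namespace Literature.NumberTheory.LFunctions.Zhang2022.Lemma83

open Literature.NumberTheory.LFunctions.Zhang2022
open Literature.NumberTheory.LFunctions.Zhang2022.Skeleton
open Literature.NumberTheory.LFunctions.Zhang2022.Typed.AppendixA1

/-- The majorant `26·10⁶·q^{−9/5} + [q ∣ dh]·4q^{−9/10}` is summable over the primes (as in
`AppendixAStepAu007ReadTail`). [folklore] -/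
private theorem summable_majorant' {d h : ℕ} (hdh : 0 < d * h) :
    Summable fun q : Nat.Primes =>
      26000000 * ((q : ℕ) : ℝ) ^ (-(9 / 5 : ℝ)) +
        (if (q : ℕ) ∣ d * h then 4 * ((q : ℕ) : ℝ) ^ (-(9 / 10 : ℝ)) else 0) := by
  have hb1 : Summable fun q : Nat.Primes => 26000000 * ((q : ℕ) : ℝ) ^ (-(9 / 5 : ℝ)) := by
    have h : Summable fun n : ℕ => (n : ℝ) ^ (-(9 / 5 : ℝ)) :=
      Real.summable_nat_rpow.mpr (by norm_num)
    exact (h.comp_injective Subtype.val_injective).mul_left _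
  set S₂ : Finset Nat.Primes := (d * h).primeFactors.subtype Nat.Prime with hS₂def
  have hb2 : Summable fun q : Nat.Primes =>
      (if (q : ℕ) ∣ d * h then 4 * ((q : ℕ) : ℝ) ^ (-(9 / 10 : ℝ)) else 0) := by
    refine summable_of_ne_finset_zero (s := S₂) fun q hq' => ?_
    have hndvd : ¬ (q : ℕ) ∣ d * h := fun h' =>
      hq' (Finset.mem_subtype.mpr (Nat.mem_primeFactors.mpr ⟨q.prop, h', hdh.ne'⟩))
    rw [if_neg hndvd]
  exact hb1.add hb2

/-- **Per-prime holomorphy ⇒ the Euler product `s ↦ ∏'_q 𝔱_j(d,h,s;q)` is holomorphic on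
`σ > 9/10`** (App. A p. 101, tex L4999: "so `𝒰_j(d,h;s)` is analytic in this region"): the
Weierstrass `M`-test for products (`Literature.Analysis.Complex.differentiableOn_tprod_of_norm_sub_one_le`)
with the summable majorant `‖𝔱_j − 1‖ ≤ 26·10⁶q^{−9/5} + [q ∣ dh]4q^{−9/10}`
(`norm_frakt_sub_one_le_all`). Any `D`, any Dirichlet character, `1 ≤ j ≤ 3`, `d, h ≥ 1`.
[cite: Zhang2022LandauSiegel, App. A p. 101, tex L4999] -/
theorem differentiableOn_tprod_frakt (c' : ℝ) {D : ℕ} (χ : DirichletCharacter ℂ D) {j : ℕ}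
    (hj : j ∈ ({1, 2, 3} : Finset ℕ)) {d h : ℕ} (hd : 1 ≤ d) (hh : 1 ≤ h)
    (hfac : ∀ q : ℕ, q.Prime →
      DifferentiableOn ℂ (fun s => frakt c' χ j d h s q) {s : ℂ | 9 / 10 < s.re}) :
    DifferentiableOn ℂ (fun s => ∏' q : Nat.Primes, frakt c' χ j d h s q)
      {s : ℂ | 9 / 10 < s.re} := by
  have hO : IsOpen {z : ℂ | 9 / 10 < z.re} := isOpen_lt continuous_const Complex.continuous_re
  have hdh : 0 < d * h := Nat.mul_pos hd hh
  exact Literature.Analysis.Complex.differentiableOn_tprod_of_norm_sub_one_le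
    (F := fun (q : Nat.Primes) (s : ℂ) => frakt c' χ j d h s q) hO (fun q => hfac q q.prop)
    (summable_majorant' hdh)
    (fun q s hs => norm_frakt_sub_one_le_all c' χ hj hd hh q.prop s hs)

end Literature.NumberTheory.LFunctions.Zhang2022.Lemma83

namespace Literature.NumberTheory.LFunctions.Zhang2022.Typed.AppendixA1

open Literature.NumberTheory.LFunctions.Zhang2022
open Literature.NumberTheory.LFunctions.Zhang2022.Skeleton

/-- **`hAn` from per-prime holomorphy**: if every local factor `s ↦ 𝔱_j(d,h,s;q)` (`q` prime,
`1 ≤ j ≤ 3`, `d, h ≥ 1`) is holomorphic on `σ > 9/10`, then `Typed.AppendixA1.StepA_u007_analytic c′`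
holds — witness `U = ∏'_q 𝔱_j(d,h,·;q)` (`Lemma83.differentiableOn_tprod_frakt`), which equals
`𝒰_j(d,h;s)` for `σ > 1` (`Lemma83.hasProd_frakt_calU`); for every `D` (threshold `0`), (A) unused.
[cite: Zhang2022LandauSiegel, App. A p. 101, tex L4999] -/
theorem stepA_u007_analytic_of_factors (c' : ℝ)
    (hfac : ∀ (D : ℕ) (χ : DirichletCharacter ℂ D) (j : ℕ), j ∈ ({1, 2, 3} : Finset ℕ) →
      ∀ d h q : ℕ, 1 ≤ d → 1 ≤ h → q.Prime →
        DifferentiableOn ℂ (fun s => frakt c' χ j d h s q) {s : ℂ | 9 / 10 < s.re}) :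
    StepA_u007_analytic c' := by
  refine ⟨0, fun D _ χ _ _ _ _ j hj d h hd hh _ => ?_⟩
  refine ⟨fun s => ∏' q : Nat.Primes, frakt c' χ j d h s q,
    Lemma83.differentiableOn_tprod_frakt c' χ hj hd hh (fun q hq => hfac D χ j hj d h q hd hh hq),
    fun s hs => ?_⟩
  exact (Lemma83.hasProd_frakt_calU c' χ j (Nat.one_le_iff_ne_zero.mp hd)
    (Nat.one_le_iff_ne_zero.mp hh) hs).tprod_eq

/-- **`hRead` from per-prime holomorphy**: under the same local hypothesis,
`Typed.AppendixA1.StepA_u007_read c′` holds (`Lemma83.stepA_u007_read_of_core` fed with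
`Lemma83.differentiableOn_tprod_frakt` and `Lemma83.hasProd_frakt_calU`): every continuation `U` of
`𝒰_j(d,h;·)` to `σ > 9/10` satisfies `‖U(s) − ∏_{q<D}𝔱_j(d,h,s;q)‖ ≤ C·D^{−3/10}` there, `D` large.
[cite: Zhang2022LandauSiegel, App. A p. 101, tex L5000] -/
theorem stepA_u007_read_of_factors (c' : ℝ)
    (hfac : ∀ (D : ℕ) (χ : DirichletCharacter ℂ D) (j : ℕ), j ∈ ({1, 2, 3} : Finset ℕ) →
      ∀ d h q : ℕ, 1 ≤ d → 1 ≤ h → q.Prime →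
        DifferentiableOn ℂ (fun s => frakt c' χ j d h s q) {s : ℂ | 9 / 10 < s.re}) :
    StepA_u007_read c' := by
  refine Lemma83.stepA_u007_read_of_core c' ⟨0, fun D _ χ _ _ _ _ j hj d h hd hh _ => ⟨?_, ?_⟩⟩
  · exact Lemma83.differentiableOn_tprod_frakt c' χ hj hd hh (fun q hq => hfac D χ j hj d h q hd hh hq)
  · intro s hs
    exact (Lemma83.hasProd_frakt_calU c' χ j (Nat.one_le_iff_ne_zero.mp hd)
      (Nat.one_le_iff_ne_zero.mp hh) hs).tprod_eq

end Literature.NumberTheory.LFunctions.Zhang2022.Typed.AppendixA1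

end
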